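import Summits.NavierStokesRegularity.NavierStokesRegularity.Theorems.SymmetricLiouville.Negative.ScrewClause
import Literature.Analysis.FluidPDE.TypeIAncientMild
import Literature.Analysis.FluidPDE.SwirlTransportProofs

/-!
# Load-bearing analysis of the STUBS of line `blowdown-kills-pitch`, I: kinematics, position, parity
# (crux `SymmetricLiouville`, stmt-NavierStokesRegularity-4053, route `SymmetryModuliCount`)

Negative lemmas about the registered stubs of the lead's skeleton
`Cruxes/SymmetricLiouville/Lines/blowdown-kills-pitch.lean` (skeleton `415f7ae75d4c`):
`stub_screwIsPeriodic` (T1), `stub_rotationCovariance` (T2), `stub_periodicBlowdownVanishing` (T3)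
(the gauge-dependent stubs T4/T5a/T5b are treated in `StubGauge.lean`). None of them is refuted;
what is proved is which hypotheses cannot be dropped, with explicit kernel-checked witnesses:

* T1 `screwIsPeriodic_false_without_notInRange`: with `a ∉ range A` weakened to `A ≠ 0` the
  kinematic stub is FALSE (`a = 0`, `A = J`: the identity field `v(x) = x` satisfies
  `Dv(x)[Jx] = Jv(x)` and has no period).
* T1 `screwIsPeriodic_false_without_skew`: without `⟪Ax, x⟫ = 0` it is FALSE (the nilpotent shear
  `A x = x₁ f₀`, `a = e_z ∉ range A`; the polynomial field `v(x) = (x₀ − x₁x₂) e_z` satisfies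
  `Dv(x)[e_z + x₁f₀] = 0 = A v(x)` and `v(· + e) = v` forces `e = 0`). So skewness is used by ANY
  proof of stub 1 (for skew `A` the flow of `a + Ax` is a screw and `e^{2πA/ρ} = 1`).
* T3 `not_blowdownVanishingAll_of_not_typeIAncientLiouville`: the periodicity hypothesis of the
  lever (stub 3) is load-bearing modulo the target: if `X = TypeIAncientLiouville` fails then, given
  stub 4, "every element of `A_C` is small at `−∞`" fails — stub 3 with `e`-periodicity dropped is
  `X`-complete (the converse direction, `X ⇒` it, is trivial).
* T2 `oseenKernel_map_linearIsometryEquiv`: the in-tree closed-form Oseen kernel is equivariant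
  under the FULL orthogonal group, `K(τ, Lz)[La, Lb] = L K(τ, z)[a, b]` for every linear isometry
  `L` (reflections included: every term is built from inner products, the radial Gaussian weights and
  the vectors `z, a, b`). So the gauge clause has no parity/orientation asymmetry to exploit, and the
  rotation-covariance stub reduces to this identity plus the tree's
  `heatExtension_comp_linearIsometryEquiv`, `VectorCalculus.IsDivFree.conj_linearIsometryEquiv` and a
  measure-preserving change of variables.
-/

noncomputable section

namespace Summit.NavierStokesRegularity.NavierStokesRegularity.Theorems.SymmetricLiouville.Negative

open Literature.Analysis.FluidPDE MeasureTheory Set Function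
open scoped RealInnerProductSpace
open Summit.NavierStokesRegularity.NavierStokesRegularity.Theses.SymmetryModuliCount (TypeIAncientLiouville)

local notation "E3" => EuclideanSpace ℝ (Fin 3)

/-! ## T1 — the kinematic stub `stub_screwIsPeriodic`: both hypotheses are load-bearing -/

/-- `J ≠ 0` (`J f₀ = e₁`). -/
theorem rotGenL_ne_zero : rotGenL ≠ 0 := by
  intro h0
  have h1 : (rotGenL f0) 1 = 0 := by rw [h0]; simp
  simp [rotGen_apply_one, f0] at h1

/-- **Stub 1 without `a ∉ range A` is false** (even with `A ≠ 0` in its place): for `a = 0`, `A = J`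
the identity field satisfies the clause `Dv(x)[a + Ax] = A v(x)` and has no nonzero period. -/
theorem screwIsPeriodic_false_without_notInRange :
    ¬ (∀ (a : E3) (A : E3 →L[ℝ] E3), (∀ x, ⟪A x, x⟫ = 0) → A ≠ 0 →
        ∃ e : E3, e ≠ 0 ∧ ∀ v : E3 → E3, Differentiable ℝ v →
          (∀ x, fderiv ℝ v x (a + A x) = A (v x)) → ∀ x, v (x + e) = v x) := by
  intro h
  obtain ⟨e, he, hper⟩ := h 0 rotGenL (fun x => by rw [rotGenL_apply]; exact inner_rotGen_self x)
    rotGenL_ne_zero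
  have key := hper id differentiable_id
    (fun x => by rw [(hasFDerivAt_id (𝕜 := ℝ) x).fderiv]; simp) 0
  rw [zero_add] at key
  exact he key

/-- The nilpotent shear generator `S x = x₁ f₀` (NOT skew: `⟪S x, x⟫ = x₀x₁`). -/
def shearGen : E3 →L[ℝ] E3 :=
  (EuclideanSpace.proj (1 : Fin 3) : E3 →L[ℝ] ℝ).smulRight f0

/-- `S x = x₁ f₀`. -/
@[simp] theorem shearGen_apply (x : E3) : shearGen x = x 1 • f0 := rfl

/-- `e_z ∉ range S` (`range S = ℝ f₀`). -/
theorem ez_not_mem_range_shearGen : ez ∉ Set.range shearGen := by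
  rintro ⟨c, hc⟩
  have h2 := congrArg (fun w : E3 => w 2) hc
  simp [ez, f0] at h2

/-- The polynomial witness `v(x) = (x₀ − x₁x₂) e_z`. -/
def twistField : E3 → E3 := fun x => (x 0 - x 1 * x 2) • ez

/-- Fréchet derivative of the witness. -/
theorem hasFDerivAt_twistField (x : E3) :
    HasFDerivAt twistField
      (((EuclideanSpace.proj (0 : Fin 3) : E3 →L[ℝ] ℝ) -
        (x 1 • (EuclideanSpace.proj (2 : Fin 3) : E3 →L[ℝ] ℝ) +
          x 2 • (EuclideanSpace.proj (1 : Fin 3) : E3 →L[ℝ] ℝ))).smulRight ez) x := by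
  have h0 : HasFDerivAt (fun v : E3 => v 0) (EuclideanSpace.proj (0 : Fin 3) : E3 →L[ℝ] ℝ) x :=
    (EuclideanSpace.proj (0 : Fin 3) : E3 →L[ℝ] ℝ).hasFDerivAt
  have h1 : HasFDerivAt (fun v : E3 => v 1) (EuclideanSpace.proj (1 : Fin 3) : E3 →L[ℝ] ℝ) x :=
    (EuclideanSpace.proj (1 : Fin 3) : E3 →L[ℝ] ℝ).hasFDerivAt
  have h2 : HasFDerivAt (fun v : E3 => v 2) (EuclideanSpace.proj (2 : Fin 3) : E3 →L[ℝ] ℝ) x :=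
    (EuclideanSpace.proj (2 : Fin 3) : E3 →L[ℝ] ℝ).hasFDerivAt
  exact ((h0.sub (h1.mul h2)).smul_const ez)

/-- The witness is differentiable. -/
theorem differentiable_twistField : Differentiable ℝ twistField := fun x =>
  (hasFDerivAt_twistField x).differentiableAt

/-- The slice derivative of the witness, evaluated. -/
theorem fderiv_twistField_apply (x h : E3) :
    fderiv ℝ twistField x h = (h 0 - (x 1 * h 2 + x 2 * h 1)) • ez := by
  rw [(hasFDerivAt_twistField x).fderiv]
  simp [ContinuousLinearMap.smulRight_apply]

/-- The witness satisfies the clause of stub 1 for the shear: `Dv(x)[e_z + S x] = S v(x)` (both `0`). -/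
theorem twistField_clause (x : E3) :
    fderiv ℝ twistField x (ez + shearGen x) = shearGen (twistField x) := by
  rw [fderiv_twistField_apply, shearGen_apply, shearGen_apply]
  simp [ez, f0, twistField]

/-- The witness has no nonzero period. -/
theorem twistField_period_eq_zero {e : E3} (hper : ∀ x, twistField (x + e) = twistField x) : e = 0 := by
  have k0 := congrArg (fun w : E3 => w 2) (hper 0)
  have k1 := congrArg (fun w : E3 => w 2) (hper e1)
  have k2 := congrArg (fun w : E3 => w 2) (hper ez)
  simp [twistField, ez, e1] at k0 k1 k2
  have he2 : e 2 = 0 := by nlinarith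
  have he1 : e 1 = 0 := by rw [he2] at k2; nlinarith
  have he0 : e 0 = 0 := by rw [he1] at k0; linarith
  ext i
  fin_cases i <;> simp [he0, he1, he2]

/-- **Stub 1 without skewness of `A` is false**: for the shear `S` and `a = e_z ∉ range S` there is
no common nonzero period of the differentiable solutions of `Dv(x)[e_z + Sx] = S v(x)` — the single
polynomial solution `(x₀ − x₁x₂) e_z` already has none. Any proof of stub 1 must use `⟪Ax, x⟫ = 0`. -/
theorem screwIsPeriodic_false_without_skew :
    ¬ (∀ (a : E3) (A : E3 →L[ℝ] E3), a ∉ Set.range A →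
        ∃ e : E3, e ≠ 0 ∧ ∀ v : E3 → E3, Differentiable ℝ v →
          (∀ x, fderiv ℝ v x (a + A x) = A (v x)) → ∀ x, v (x + e) = v x) := by
  intro h
  obtain ⟨e, he, hper⟩ := h ez shearGen ez_not_mem_range_shearGen
  exact he (twistField_period_eq_zero (hper twistField differentiable_twistField twistField_clause))

/-! ## T3 — the periodicity hypothesis of the lever is load-bearing modulo the target `X` -/

/-- **Stub 3 with periodicity dropped is `X`-complete.** If the target `X = TypeIAncientLiouville`
fails then — granted stub 4 ("small at `−∞` ⇒ 0", which the line proves from the gap theorem) — it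
is NOT true that every element of `A_C` is small at `−∞`: a nonzero element would otherwise be
killed. (Conversely `X` makes both statements trivial.) So the blow-down lever genuinely needs the
shrinking period; without it the stub is the whole problem. -/
theorem not_blowdownVanishingAll_of_not_typeIAncientLiouville (hX : ¬ TypeIAncientLiouville)
    (h4 : ∀ (C : ℝ) (u : ℝ → E3 → E3), IsTypeIAncientMild C u →
      (∀ ε > 0, ∃ T < 0, ∀ t < T, ∀ x, Real.sqrt (-t) * ‖u t x‖ ≤ ε) → ∀ t < 0, ∀ x, u t x = 0) :
    ¬ (∀ (C : ℝ) (u : ℝ → E3 → E3), IsTypeIAncientMild C u →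
      ∀ ε > 0, ∃ T < 0, ∀ t < T, ∀ x, Real.sqrt (-t) * ‖u t x‖ ≤ ε) := by
  intro h3
  apply hX
  intro C u hu
  have hcl : IsTypeIAncientMild C u := isTypeIAncientMild_iff.2 hu
  exact h4 C u hcl (h3 C u hcl)

/-! ## T2 — no orientation/parity asymmetry in the gauge: the Oseen kernel is `O(3)`-equivariant -/

/-- **The closed-form Oseen kernel is equivariant under every linear isometry** (rotations AND
reflections): `K(τ, Lz)[La, Lb] = L (K(τ, z)[a, b])`. -/
theorem oseenKernel_map_linearIsometryEquiv (L : E3 ≃ₗᵢ[ℝ] E3) (τ : ℝ) (z a b : E3) :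
    oseenKernel τ (L z) (L a) (L b) = L (oseenKernel τ z a b) := by
  have hG : ∀ s : ℝ, Literature.Analysis.UnboundedOperators.heatKernel s (L z) =
      Literature.Analysis.UnboundedOperators.heatKernel s z := fun s => by
    rw [Literature.Analysis.UnboundedOperators.heatKernel_eq,
      Literature.Analysis.UnboundedOperators.heatKernel_eq, L.norm_map]
  have hA : oseenWeightA τ (L z) = oseenWeightA τ z := by
    simp only [oseenWeightA, hG]
  have hB : oseenWeightB τ (L z) = oseenWeightB τ z := by
    simp only [oseenWeightB, hG]
  simp only [oseenKernel, LinearIsometryEquiv.inner_map_map, hG, hA, hB, map_add, map_sub,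
    LinearIsometryEquiv.map_smul]

end Summit.NavierStokesRegularity.NavierStokesRegularity.Theorems.SymmetricLiouville.Negative

end
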